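import Summits.Ventures.PercRepro.RankLevelSetRuleQCell
import Summits.Ventures.PercRepro.RankLevelSetRuleQCellEnds

/-!
# PercRepro — (R̂) AT `m = 1` FOR EVERY `q`, `k`: THE TELESCOPING PROOF IN THE KERNEL (night-1, gen 14; dossier §23.8′)

`Φ(q+k, q) ≤ R̂(q, k, 1)` for all `q ≥ 1`, `k ≥ 2` — the member's complementary basis meets its flat in ONE element (the
numerically tightest regime of (R̂): margin `q(k−1)/((q+k)(q+1))`; the Prop `RhatIneq` itself is false from `q = 72` on,
p4 g19, but its `m ≤ 1` and `m = q` instances hold for every `q`, `k`).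
* `mhat_one_zero_le`, `mhat_one_one_le` — the Vandermonde bounds `m̂(q,1;0,j) ≤ C(q+j, j)`, `m̂(q,1;1,j) ≤ C(q+j+1, j+1)`
  (the co-independence truncation only lowers `m̂`);
* `phiK_eq_sum_range` — `Φ(q+k, q) = Σ_{i<k−1} C(q+k, i+1) / C(q+i+1, q)` (termwise `C(2q+k, q+1+i)/C(2q+k, q+k) =
  C(q+k, 1+i)/C(q+1+i, q)` by `Nat.choose_mul`);
* **`rhatCell_one`** — `Φ(q+k, q) ≤ R̂(q, k, 1)`: Pascal on `C(q+k, i+1)` and the two sums telescope to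
  `C(q+k−1, k−1)/C(q+k, q) − 1/(q+1) = q(k−1)/((q+k)(q+1)) ≥ 0`;
* `rhat_zero_eq` — `R̂(q, k, 0) = Φ(q+k, q)` (the uniform case, equality);
* **`ruleQRecv_ge_of_flatPart_le_one`**, **`ruleQRecv_ge_of_flatPart_eq`** — at the tight layer `#E = (q+k) + q` every member
  `Z` whose complementary basis meets `cl Z` in at most one element, or in a basis of `cl Z` (`#P = q`), receives at least
  `Φ(q+k, q)` under the equal split (Rule Q at such members, in every finite matroid; with `rhat_le_ruleQRecv`).
Axioms: standard.
-/

namespace PercRepro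

open Finset

/-- Vandermonde, diagonal form: `Σ_{t ≤ j} C(q, t)·C(j, t) = C(q + j, j)`. -/
lemma sum_choose_mul_choose_eq (q j : ℕ) :
    (∑ t ∈ Finset.range (j + 1), q.choose t * j.choose t) = (q + j).choose j := by
  rw [Nat.add_choose_eq q j j, Finset.Nat.sum_antidiagonal_eq_sum_range_succ (fun a b => q.choose a * j.choose b)]
  apply Finset.sum_congr rfl
  intro t ht
  rw [Finset.mem_range] at ht
  rw [Nat.choose_symm (by omega)]

/-- Vandermonde, shifted: `Σ_{t ≤ j} C(q, t+1)·C(j, t) = C(q + j, j + 1)`. -/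
lemma sum_choose_succ_mul_choose_eq (q j : ℕ) :
    (∑ t ∈ Finset.range (j + 1), q.choose (t + 1) * j.choose t) = (q + j).choose (j + 1) := by
  rw [Nat.add_choose_eq q j (j + 1),
    Finset.Nat.sum_antidiagonal_eq_sum_range_succ (fun a b => q.choose a * j.choose b)]
  simp only [Nat.succ_eq_add_one]
  rw [Finset.sum_range_succ' (fun a => q.choose a * j.choose (j + 1 - a)) (j + 1)]
  simp only [Nat.choose_zero_right, one_mul, Nat.sub_zero, Nat.choose_succ_self, add_zero]
  apply Finset.sum_congr rfl
  intro t ht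
  rw [Finset.mem_range] at ht
  congr 1
  rw [show j + 1 - (t + 1) = j - t by omega, Nat.choose_symm (by omega)]

/-- `m̂(q, 1; 0, j) ≤ C(q + j, j)`: dropping the truncation at `q − 1` only adds nonnegative terms. -/
lemma mhat_one_zero_le (q j : ℕ) : mhat q 1 0 j ≤ (q + j).choose j := by
  rw [← sum_choose_mul_choose_eq q j]
  unfold mhat
  simp only [Finset.sum_range_one, Nat.choose_zero_right, zero_add, mul_one]
  apply Finset.sum_le_sum_of_subset_of_nonneg
  · intro t ht
    rw [Finset.mem_range] at ht ⊢
    have := min_le_left j (q - 1)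
    omega
  · intros; positivity

/-- `m̂(q, 1; 1, j) ≤ C(q + j + 1, j + 1)`: the two `t_P`-slices are bounded by the two Vandermonde sums, Pascal adds them. -/
lemma mhat_one_one_le (q j : ℕ) : mhat q 1 1 j ≤ (q + j + 1).choose (j + 1) := by
  have h0 : (∑ tD ∈ Finset.range (min j (q - 1) + 1), q.choose (0 + tD) * (1 : ℕ).choose 0 * j.choose tD)
      ≤ (q + j).choose j := by
    rw [← sum_choose_mul_choose_eq q j]
    simp only [zero_add, Nat.choose_zero_right, mul_one]
    apply Finset.sum_le_sum_of_subset_of_nonneg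
    · intro t ht
      rw [Finset.mem_range] at ht ⊢
      have := min_le_left j (q - 1)
      omega
    · intros; positivity
  have h1 : (∑ tD ∈ Finset.range (min j (q - 1) + 1), q.choose (1 + tD) * (1 : ℕ).choose 1 * j.choose tD)
      ≤ (q + j).choose (j + 1) := by
    rw [← sum_choose_succ_mul_choose_eq q j]
    simp only [Nat.choose_self, mul_one]
    have hc : ∀ t, q.choose (1 + t) = q.choose (t + 1) := fun t => by rw [add_comm]
    simp only [hc]
    apply Finset.sum_le_sum_of_subset_of_nonneg
    · intro t ht
      rw [Finset.mem_range] at ht ⊢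
      have := min_le_left j (q - 1)
      omega
    · intros; positivity
  unfold mhat
  rw [Finset.sum_range_succ, Finset.sum_range_one, Nat.choose_succ_succ' (q + j) j]
  omega

/-- `Φ(q + k, q)` as the range-sum `Σ_{i < k−1} C(q+k, i+1) / C(q+i+1, q)` (termwise via `Nat.choose_mul`). -/
lemma phiK_eq_sum_range (q k : ℕ) (hk : 1 ≤ k) :
    phiK (q + k) q = ∑ i ∈ Finset.range (k - 1), ((q + k).choose (i + 1) : ℚ) / ((q + i + 1).choose q : ℚ) := by
  unfold phiK
  rw [sum_Ioo_nat, show q + k - (q + 1) = k - 1 by omega, Finset.sum_div]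
  apply Finset.sum_congr rfl
  intro i hi
  rw [Finset.mem_range] at hi
  have hsym : (q + k + q).choose (q + k) = (q + k + q).choose q := by
    rw [show q + k + q = q + (q + k) by ring, Nat.choose_symm_add]
  have hmul := Nat.choose_mul (n := q + k + q) (k := q + 1 + i) (s := q) (by omega)
  rw [show q + k + q - q = q + k by omega, show q + 1 + i - q = i + 1 by omega] at hmul
  have hpos1 : (0 : ℚ) < ((q + k + q).choose (q + k) : ℚ) := by exact_mod_cast Nat.choose_pos (by omega)
  have hpos2 : (0 : ℚ) < ((q + i + 1).choose q : ℚ) := by exact_mod_cast Nat.choose_pos (by omega)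
  rw [div_eq_div_iff hpos1.ne' hpos2.ne', hsym]
  have hmul' : ((q + k + q).choose (q + 1 + i) : ℚ) * ((q + 1 + i).choose q : ℚ)
      = ((q + k + q).choose q : ℚ) * ((q + k).choose (i + 1) : ℚ) := by exact_mod_cast hmul
  rw [show q + i + 1 = q + 1 + i by ring]
  linarith [hmul']

/-- The lower bound `L(q,k) := Σ_{i<k−1} C(q+k−1, i+1)·(1/C(q+i+1, q) + 1/C(q+i+2, q)) ≤ R̂(q, k, 1)`. -/
lemma sum_le_rhat_one (q k : ℕ) (hq : 1 ≤ q) :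
    (∑ i ∈ Finset.range (k - 1), ((q + k - 1).choose (i + 1) : ℚ) *
      (1 / ((q + i + 1).choose q : ℚ) + 1 / ((q + i + 2).choose q : ℚ))) ≤ rhat q k 1 := by
  unfold rhat
  rw [sum_Ioo_nat, show k - (0 + 1) = k - 1 by omega]
  apply Finset.sum_le_sum
  intro i _
  rw [Finset.sum_range_succ, Finset.sum_range_one]
  simp only [Nat.choose_zero_right, Nat.choose_self, one_mul, zero_add]
  have hA : ((q + k - 1).choose (0 + 1 + i) : ℚ) = ((q + k - 1).choose (i + 1) : ℚ) := by
    rw [show 0 + 1 + i = i + 1 by ring]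
  have hB : (q + 1 - 1 : ℕ) = q := by omega
  rw [show q + k - 1 = q + k - 1 from rfl]
  have hm0 : (mhat q 1 0 (0 + 1 + i) : ℚ) ≤ ((q + i + 1).choose q : ℚ) := by
    have := mhat_one_zero_le q (0 + 1 + i)
    rw [show q + (0 + 1 + i) = q + i + 1 by ring, show (q + i + 1).choose (0 + 1 + i) = (q + i + 1).choose q by
      rw [show q + i + 1 = q + (i + 1) by ring, Nat.choose_symm_add, show 0 + 1 + i = i + 1 by ring]] at this
    exact_mod_cast this
  have hm1 : (mhat q 1 1 (0 + 1 + i) : ℚ) ≤ ((q + i + 2).choose q : ℚ) := by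
    have := mhat_one_one_le q (0 + 1 + i)
    rw [show q + (0 + 1 + i) + 1 = q + (i + 2) by ring, show 0 + 1 + i + 1 = i + 2 by ring,
      ← Nat.choose_symm_add, show q + (i + 2) = q + i + 2 by ring] at this
    exact_mod_cast this
  have hpos0 : (0 : ℚ) < (mhat q 1 0 (0 + 1 + i) : ℚ) := by
    have : 0 < mhat q 1 0 (0 + 1 + i) := by
      unfold mhat
      apply Finset.sum_pos
      · intro tP htP
        apply Finset.sum_pos
        · intro tD htD
          rw [Finset.mem_range] at htP htD
          have hq' : tP + tD ≤ q := by
            have := min_le_right (0 + 1 + i) (q - 1)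
            omega
          have hj' : tD ≤ 0 + 1 + i := by
            have := min_le_left (0 + 1 + i) (q - 1)
            omega
          have htp : tP ≤ 0 := by omega
          exact Nat.mul_pos (Nat.mul_pos (Nat.choose_pos hq') (Nat.choose_pos htp)) (Nat.choose_pos hj')
        · exact ⟨0, by simp⟩
      · exact ⟨0, by simp⟩
    exact_mod_cast this
  have hpos1 : (0 : ℚ) < (mhat q 1 1 (0 + 1 + i) : ℚ) := by
    have : 0 < mhat q 1 1 (0 + 1 + i) := by
      unfold mhat
      apply Finset.sum_pos
      · intro tP htP
        apply Finset.sum_pos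
        · intro tD htD
          rw [Finset.mem_range] at htP htD
          have hq' : tP + tD ≤ q := by
            have := min_le_right (0 + 1 + i) (q - 1)
            omega
          have hj' : tD ≤ 0 + 1 + i := by
            have := min_le_left (0 + 1 + i) (q - 1)
            omega
          have htp : tP ≤ 1 := by omega
          exact Nat.mul_pos (Nat.mul_pos (Nat.choose_pos hq') (Nat.choose_pos htp)) (Nat.choose_pos hj')
        · exact ⟨0, by simp⟩
      · exact ⟨0, by simp⟩
    exact_mod_cast this
  have hc : (0 : ℚ) ≤ ((q + k - 1).choose (i + 1) : ℚ) := Nat.cast_nonneg _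
  rw [hA, mul_add]
  apply add_le_add
  · rw [mul_one_div]
    exact div_le_div_of_nonneg_left hc hpos0 hm0
  · rw [mul_one_div]
    exact div_le_div_of_nonneg_left hc hpos1 hm1

/-- **(R̂) at `m = 1` for every `q ≥ 1`, `k ≥ 2`**: `Φ(q+k, q) ≤ R̂(q, k, 1)` (the telescoping of dossier §23.8′). -/
theorem rhatCell_one (q k : ℕ) (hq : 1 ≤ q) (hk : 2 ≤ k) : phiK (q + k) q ≤ rhat q k 1 := by
  refine le_trans ?_ (sum_le_rhat_one q k hq)
  rw [phiK_eq_sum_range q k (by omega)]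
  -- G i := C(q+k−1, i)/C(q+i+1, q), A i := C(q+k−1, i+1)/C(q+i+1, q); Φ = Σ (G i + A i), L = Σ (A i + G (i+1))
  set G : ℕ → ℚ := fun i => ((q + k - 1).choose i : ℚ) / ((q + i + 1).choose q : ℚ) with hG
  set A : ℕ → ℚ := fun i => ((q + k - 1).choose (i + 1) : ℚ) / ((q + i + 1).choose q : ℚ) with hA
  have hpascal : ∀ i, ((q + k).choose (i + 1) : ℚ) = ((q + k - 1).choose i : ℚ) + ((q + k - 1).choose (i + 1) : ℚ) := by
    intro i
    have : (q + k).choose (i + 1) = (q + k - 1).choose i + (q + k - 1).choose (i + 1) := by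
      rw [show q + k = (q + k - 1) + 1 by omega, Nat.choose_succ_succ', Nat.add_sub_cancel]
    exact_mod_cast this
  have hΦ : (∑ i ∈ Finset.range (k - 1), ((q + k).choose (i + 1) : ℚ) / ((q + i + 1).choose q : ℚ))
      = (∑ i ∈ Finset.range (k - 1), G i) + ∑ i ∈ Finset.range (k - 1), A i := by
    rw [← Finset.sum_add_distrib]
    apply Finset.sum_congr rfl
    intro i _
    rw [hpascal i, add_div]
  have hL : (∑ i ∈ Finset.range (k - 1), ((q + k - 1).choose (i + 1) : ℚ) *
      (1 / ((q + i + 1).choose q : ℚ) + 1 / ((q + i + 2).choose q : ℚ)))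
      = (∑ i ∈ Finset.range (k - 1), A i) + ∑ i ∈ Finset.range (k - 1), G (i + 1) := by
    rw [← Finset.sum_add_distrib]
    apply Finset.sum_congr rfl
    intro i _
    simp only [hG, hA]
    rw [show q + (i + 1) + 1 = q + i + 2 by ring, mul_add, mul_one_div, mul_one_div]
  rw [hΦ, hL]
  -- it remains: Σ_{i<k−1} G i ≤ Σ_{i<k−1} G (i+1), i.e. G 0 ≤ G (k−1) (telescoping)
  have htel : (∑ i ∈ Finset.range (k - 1), G (i + 1)) - ∑ i ∈ Finset.range (k - 1), G i = G (k - 1) - G 0 := by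
    have h1 := Finset.sum_range_succ G (k - 1)
    have h2 := Finset.sum_range_succ' G (k - 1)
    rw [h2] at h1
    linarith
  have hG0 : G 0 = 1 / (q + 1 : ℚ) := by
    have hc : (q + 1).choose q = q + 1 := by rw [Nat.choose_symm_add, Nat.choose_one_right]
    simp only [hG, Nat.choose_zero_right, Nat.cast_one, add_zero, hc]
    push_cast
    ring
  have hGk : 1 / (q + 1 : ℚ) ≤ G (k - 1) := by
    simp only [hG]
    have hsym : (q + (k - 1) + 1).choose q = (q + k).choose k := by
      rw [show q + (k - 1) + 1 = q + k by omega, Nat.choose_symm_add]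
    rw [hsym]
    have hpos : (0 : ℚ) < ((q + k).choose k : ℚ) := by exact_mod_cast Nat.choose_pos (by omega)
    rw [div_le_div_iff₀ (by positivity) hpos, one_mul]
    -- (q+1)·C(q+k−1, k−1) ≥ C(q+k, k): from (q+k)·C(q+k−1, k−1) = k·C(q+k, k) and k(q+1) ≥ q+k
    have hmul := Nat.add_one_mul_choose_eq (q + k - 1) (k - 1)
    rw [show q + k - 1 + 1 = q + k by omega, show k - 1 + 1 = k by omega] at hmul
    have hmulq : ((q + k : ℕ) : ℚ) * ((q + k - 1).choose (k - 1) : ℚ) = ((q + k).choose k : ℚ) * (k : ℚ) := by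
      exact_mod_cast hmul
    have hkq : ((q + k : ℕ) : ℚ) ≤ (k : ℚ) * (q + 1) := by
      have hq' : (1 : ℚ) ≤ (q : ℚ) := by exact_mod_cast hq
      have hk' : (2 : ℚ) ≤ (k : ℚ) := by exact_mod_cast hk
      have hprod : (0 : ℚ) ≤ (q : ℚ) * ((k : ℚ) - 1) := mul_nonneg (by linarith) (by linarith)
      push_cast
      nlinarith [hprod]
    have hc : (0 : ℚ) ≤ ((q + k - 1).choose (k - 1) : ℚ) := Nat.cast_nonneg _
    have hkpos : (0 : ℚ) < (k : ℚ) := by exact_mod_cast (by omega : 0 < k)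
    nlinarith
  linarith [htel, hG0, hGk]

/-- `m̂(q, 0; 0, j) = C(q + j, j)`: the truncation at `q` only removes vanishing terms of the Vandermonde sum. -/
lemma mhat_zero_zero (q j : ℕ) : mhat q 0 0 j = (q + j).choose j := by
  rw [← sum_choose_mul_choose_eq q j]
  unfold mhat
  simp only [Finset.sum_range_one, Nat.choose_zero_right, zero_add, mul_one, Nat.sub_zero]
  apply Finset.sum_subset
  · intro t ht
    rw [Finset.mem_range] at ht ⊢
    have := min_le_left j q
    omega
  · intro t ht hnot
    rw [Finset.mem_range] at ht hnot
    have hq : q < t := by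
      have := min_le_right j q
      omega
    rw [Nat.choose_eq_zero_of_lt hq, zero_mul]

/-- **(R̂) at `m = 0` is an equality**: `R̂(q, k, 0) = Φ(q+k, q)` (the uniform matroid). -/
theorem rhat_zero_eq (q k : ℕ) (hk : 1 ≤ k) : rhat q k 0 = phiK (q + k) q := by
  rw [phiK_eq_sum_range q k hk]
  unfold rhat
  rw [sum_Ioo_nat, show k - (0 + 1) = k - 1 by omega]
  apply Finset.sum_congr rfl
  intro i _
  rw [Finset.sum_range_one]
  simp only [Nat.choose_zero_right, one_mul, Nat.sub_zero]
  rw [mhat_zero_zero, show 0 + 1 + i = i + 1 by ring, show q + (i + 1) = q + i + 1 by ring,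
    show (q + i + 1).choose (i + 1) = (q + i + 1).choose q by
      rw [show q + i + 1 = q + (i + 1) by ring, Nat.choose_symm_add]]

variable {α : Type} (M : Matroid α) [M.Finite]

/-- **Rule Q at the members with `#P ≤ 1`** (every finite matroid at the tight layer of the cell `(q+k, q)`): if the
complementary basis of the member `Z` meets `cl Z` in at most one element, `Z` receives at least `Φ(q+k, q)`. -/
theorem ruleQRecv_ge_of_flatPart_le_one {q k : ℕ} (hq : 1 ≤ q) (hk : 2 ≤ k) (hE : M.E.ncard = (q + k) + q)
    {Z : Set α} (hZ : Z ∈ cellMembers M (q + k) q) (hP : (flatPart M Z).ncard ≤ 1) :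
    phiK (q + k) q ≤ ruleQRecv M (q + k) q Z := by
  refine le_trans ?_ (rhat_le_ruleQRecv M hE hZ)
  rcases Nat.le_one_iff_eq_zero_or_eq_one.mp hP with h0 | h1
  · rw [h0, rhat_zero_eq q k (by omega)]
  · rw [h1]
    exact rhatCell_one q k hq hk

/-- **Rule Q at the members with `#P = q`** (the complementary basis contains a basis of `cl Z`): such a member
receives at least `Φ(q+k, q)`. -/
theorem ruleQRecv_ge_of_flatPart_eq {q k : ℕ} (hk : 2 ≤ k) (hE : M.E.ncard = (q + k) + q)
    {Z : Set α} (hZ : Z ∈ cellMembers M (q + k) q) (hP : (flatPart M Z).ncard = q) :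
    phiK (q + k) q ≤ ruleQRecv M (q + k) q Z := by
  refine le_trans ?_ (rhat_le_ruleQRecv M hE hZ)
  rw [hP]
  exact rhatCell_self q k hk

end PercRepro
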